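import Summits.ABC.IUTFork.EtThZNChainUnconditional
import Literature.AnabelianGeometry.EtaleTheta.Discharge.Sec1ZNCentralKernelOfOrigins
import Literature.AnabelianGeometry.EtaleTheta.Discharge.Sec2HypsOfOrigins
import HarnessLib

/-!
# [EtTh] §1 `Z_N` chain AT A JOINT ORIGIN: the ∀-form of the origin clause from print's DEFINITION of `Z_N` alone, and
# the K3 end-knit with its `Z_N` inputs reduced to that definition (Summits-side assembly, `hsc` discharged)

Cell `abc-iut`, layer L2, [EtTh] §1 p. 14 [cite: MochizukiEtTh2009, §1 p.14].  Sequel of `EtThZNChainUnconditional` (this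
seat, p461655 … p473212).  This seat's `Discharge/Sec1ZNCentralKernelOfOrigins` proves the centrality clause `hcen` of the
root uniqueness theorem (p470538) at every theta setting carrying `IsEtThOrigin`, `HasThetaTopology`, `IsThm16Origin`,
`IsTateOrigin` (`ThetaSetting.hcen_of_origins`).  Plugging the Summits-side strong completeness of `G_{ℚ_p}`
(`stronglyComplete_GQp`):

* `gtpZNFromSplitting_of_exists_of_origins_unconditional` — at a joint origin, the ∀-form `GtpZNFromSplitting D N` follows from
  the ∃-form (SOME lifted splitting over `G_{K_N}` cuts out `Π^tp_{Z_N}` = how print DEFINES `Z_N`) with NO further hypothesis;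
* `thm16iii_of_origins_of_znDef_of_origins_unconditional` — abc-iut-L2-t1's K3 end-knit v6 (`Thm16Sub.thm16iii_of_origins_of_znDef`,
  p471699) with `hsc` discharged AND both centrality binders `hcenα`/`hcenβ` DERIVED; the α side therefore also displays
  `IsEtThOrigin`/`HasThetaTopology`.  NET per-side `Z_N` input of [EtTh] Thm 1.6 (iii) at the origin predicates: print's
  ∃-form definition of `Z_N` ONLY.

Proof-only assembly (no definition, no named fact, no `sorry`); seat abc-iut-w5-d062 (gen 5).  HONEST FRAMING: the origin
predicates are hypotheses inhabited only at semi-synthetic models (consistency evidence); classical inputs are theorems of the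
tree; nothing here asserts anything about abc or takes a side on [IUTchIII] Cor. 3.12; typed ≠ proved for the nodes themselves.
-/

noncomputable section

namespace Summit.ABC.IUTFork

open Literature.AnabelianGeometry.EtaleTheta Literature.AnabelianGeometry.SemiGraphs
open Literature.AnabelianGeometry.AbsoluteAnabelian Field

variable {p : ℕ} [Fact p.Prime]

/-- **`GtpZNFromSplitting` (∀-form) from print's DEFINITION of `Z_N` at a joint origin — NO classical hypothesis, NO structural
binder** (this seat's `ThetaSetting.gtpZNFromSplitting_of_exists_of_origins` with `hsc := stronglyComplete_GQp p`).
[cite: MochizukiEtTh2009, §1 p.14] -/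
theorem gtpZNFromSplitting_of_exists_of_origins_unconditional (D : ThetaSetting p) (hO : D.IsEtThOrigin)
    (hTop : D.HasThetaTopology) (h16 : D.IsThm16Origin) (hT : D.IsTateOrigin) (N : ℕ+)
    (hex : ∃ s₀ : ↥(D.GKN N) → D.GtpTheta, D.IsThetaSplittingAt N s₀ ∧
      ∀ g : D.PiTemp, g ∈ D.GtpZN N ↔ g ∈ D.GtpYN N ∧ ∃ h : D.aug g ∈ D.GJN N,
        D.toTheta g * (s₀ ⟨D.aug g, D.GJN_le_GKN N h⟩)⁻¹ ∈ D.thetaPowersY N) :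
    D.GtpZNFromSplitting N :=
  ThetaSetting.gtpZNFromSplitting_of_exists_of_origins hO hTop h16 hT (stronglyComplete_GQp p) N hex

/-- **[EtTh] Theorem 1.6 (iii) at the origin predicates — K3 end-knit with `hsc` DISCHARGED and `hcen` DERIVED**: abc-iut-L2-t1's
v6 knit (`Thm16Sub.thm16iii_of_origins_of_znDef`, p471699; Summits-side `thm16iii_of_origins_of_znDef_unconditional`, p473212)
with the two centrality binders `hcenα`/`hcenβ` replaced by the theorem `ThetaSetting.hcen_of_origins` — the α side therefore
also displays `IsEtThOrigin` and `HasThetaTopology` (the β side already did).  NET covering inputs of record: {`IsEtThOrigin`,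
`HasThetaTopology`, `IsThm16Origin`, `IsTateOrigin` on both sides, `hΔ` ([AbsAnab] Lem 1.3.8), `h65` ([SemiAnbd] Thm 6.5 (iii)),
per side print's ∃-form DEFINITION of `Z_N`}, plus the Prop 1.5 / valuation / inversion / cusp-evaluation inputs verbatim — NO
classical hypothesis, NO structural `Z_N` binder. [cite: MochizukiEtTh2009, Thm 1.6 (iii) p.25] -/
theorem thm16iii_of_origins_of_znDef_of_origins_unconditional {Dα Dβ : ThetaSetting p} {γ : Dα.PiTemp ≃ₜ* Dβ.PiTemp}
    (hOα : Dα.IsEtThOrigin) (hTopα : Dα.HasThetaTopology)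
    (hα : Dα.IsThm16Origin) (hβ : Dβ.IsThm16Origin)
    (hTα : Dα.IsTateOrigin) (hTβ' : Dβ.IsTateOrigin)
    (h : ThetaSetting.Thm16i γ) (c : ThetaSetting.ThetaCompanion γ)
    (hΔ : Dα.DeltaTemp.map γ.toMulEquiv.toMonoidHom = Dβ.DeltaTemp)
    (h65 : Dα.IsoPreservesCuspidalDecomp Dβ.toTemperedCurve)
    (hexα : ∀ N : ℕ+, ∃ s₀ : ↥(Dα.GKN N) → Dα.GtpTheta, Dα.IsThetaSplittingAt N s₀ ∧
      ∀ g : Dα.PiTemp, g ∈ Dα.GtpZN N ↔ g ∈ Dα.GtpYN N ∧ ∃ h' : Dα.aug g ∈ Dα.GJN N,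
        Dα.toTheta g * (s₀ ⟨Dα.aug g, Dα.GJN_le_GKN N h'⟩)⁻¹ ∈ Dα.thetaPowersY N)
    (hexβ : ∀ N : ℕ+, ∃ s₀ : ↥(Dβ.GKN N) → Dβ.GtpTheta, Dβ.IsThetaSplittingAt N s₀ ∧
      ∀ g : Dβ.PiTemp, g ∈ Dβ.GtpZN N ↔ g ∈ Dβ.GtpYN N ∧ ∃ h' : Dβ.aug g ∈ Dβ.GJN N,
        Dβ.toTheta g * (s₀ ⟨Dβ.aug g, Dβ.GJN_le_GKN N h'⟩)⁻¹ ∈ Dβ.thetaPowersY N)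
    (Eα : Dα.EtaleThetaData) (Eβ : Dβ.EtaleThetaData) (hCα : Dα.Compat) (hCβ : Dβ.Compat)
    (hSβ : Dβ.Sec2Hyps) (h15iiα : ThetaSetting.Prop15ii Eα.toKummerData hCα)
    (h15ii : ThetaSetting.Prop15ii Eβ.toKummerData hCβ)
    (h15α : ThetaSetting.Prop15iii Eα hCα) (h15β : ThetaSetting.Prop15iii Eβ hCβ)
    {σ : Dβ.PiTemp} (hσ : σ ∈ Dβ.GtpYdd)
    (Vα : ThetaSetting.ValuationHatData Dα Eα.toKummerData)
    (Vβ : ThetaSetting.ValuationHatData Dβ Eβ.toKummerData)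
    (hVα : Vα.unitsHat = Dα.unitsOKdd.map Eα.toKddHat) (hVβ : Vβ.unitsHat = Dβ.unitsOKdd.map Eβ.toKddHat)
    (h16ii : ThetaSetting.Thm16ii γ h Eα.toKummerData Eβ.toKummerData Vα Vβ)
    (hTβ : Dβ.HasThetaTopology) (hOβ : Dβ.IsEtThOrigin)
    {lamβ : ↥((Dβ.DtpYddN 1).map Dβ.toTheta) →ₜ* Dβ.DeltaTheta} (hstdβ : ThetaSetting.IsStdLog lamβ)
    (hresβ : ContH1.res (MonoidHom.id Dβ.GtpTheta) Dβ.DeltaTheta Dβ.map_toTheta_DtpYddN_one_le Eβ.logUdd =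
      ThetaSetting.homClass ThetaSetting.dtpYddTheta_le_deltaTheta_map lamβ)
    {ια : Dα.PiTemp ≃ₜ* Dα.PiTemp} (hια : Dα.IsInversionAut ια) (cα : ThetaSetting.ThetaCompanion ια)
    (hInvα : ThetaSetting.InvClauses Eα hια cα)
    (h15invβ : Dβ.Prop15iiiInvAnchored Eβ)
    (yβ : ThetaSetting.CuspidalPointDd Eβ.toKummerData) (hyβA : yβ.IsAnchored) (hyβ0 : yβ.IsOnLabelZero)
    (hyβfix : Dβ.FixesCuspBelow ((γ.symm.trans ια).trans γ) yβ)
    (y : ThetaSetting.CuspidalPointDd Eβ.toKummerData) {u₁ u₂ v₁ v₂ : (↥Dβ.Kdd)ˣ}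
    (hu₁ : u₁ ∈ Dβ.unitsOKdd) (hu₂ : u₂ ∈ Dβ.unitsOKdd)
    (hv : ‖((v₁ : Dβ.Kdd) : PadicAlgCl p)‖ = ‖((v₂ : Dβ.Kdd) : PadicAlgCl p)‖)
    (h₁ : haveI := hCβ.GtpYdd_normal
      y.evalAt (ContH1.res Dβ.toTheta Dβ.DeltaTheta (y.sec_le.trans y.Dpt_le)
        (ContH1.conj Dβ.toTheta Dβ.DeltaTheta σ Eβ.etaDd)) = Eβ.toKddHat (u₁ * v₁))
    (h₂ : y.evalAt (ContH1.res Dβ.toTheta Dβ.DeltaTheta (y.sec_le.trans y.Dpt_le)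
        (ThetaSetting.transport c h Eα.etaDd)) = Eβ.toKddHat (u₂ * v₂)) :
    ThetaSetting.Thm16iii γ h c Eα Eβ hCβ :=
  thm16iii_of_origins_of_znDef_unconditional hα hβ hTα hTβ' h c hΔ h65
    (fun N => ThetaSetting.hcen_of_origins hOα hTopα hα hTα N) hexα
    (fun N => ThetaSetting.hcen_of_origins hOβ hTβ hβ hTβ' N) hexβ
    Eα Eβ hCα hCβ hSβ h15iiα h15ii h15α h15β hσ Vα Vβ hVα hVβ h16ii
    hTβ hOβ hstdβ hresβ hια cα hInvα h15invβ yβ hyβA hyβ0 hyβfix y hu₁ hu₂ hv h₁ h₂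

/-! ## Addendum v2 (seat abc-iut-w5-d062 gen 5): `Sec2Hyps` on the β side reduced to print's «`K = K̈`»; `Compat` supplied

This seat's `Discharge/Sec2HypsOfOrigins` proves `Sec2Hyps` ⟸ {«`K = K̈`», `IsThm16Origin`, `IsTateOrigin`}
(`ThetaSetting.sec2Hyps_of_Kdd_eq_of_origins`); the β side of the knit carries both origin predicates, so its binder
`hSβ : Dβ.Sec2Hyps` becomes the printed standing assumption `hKβ : Dβ.Kdd = Dβ.K` (Def. 2.5 p. 39 / Def. 1.7 (I) p. 27). -/

/-- **[EtTh] Theorem 1.6 (iii) at the origin predicates — `hsc` discharged, `hcen` derived, `Sec2Hyps` ⟸ «`K̈ = K`»**: as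
`thm16iii_of_origins_of_znDef_of_origins_unconditional` with the β-side binder `hSβ : Dβ.Sec2Hyps` replaced by print's standing
assumption `hKβ : Dβ.Kdd = Dβ.K` (this seat's `ThetaSetting.sec2Hyps_of_Kdd_eq_of_origins`) and the §1 hypothesis structures
`hCα`/`hCβ : Compat` supplied by abc-iut-L2-t1's unconditional `ThetaSetting.compat` (holds for EVERY setting).  NET structural inputs of record:
{`IsEtThOrigin`, `HasThetaTopology`, `IsThm16Origin`, `IsTateOrigin` on both sides, «`K̈β = Kβ`», `hΔ`, `h65`, per side print's ∃-form
definition of `Z_N`} + the Prop 1.5 / valuation / inversion / cusp-evaluation inputs verbatim. [cite: MochizukiEtTh2009, Thm 1.6 (iii) p.25] -/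
theorem thm16iii_of_origins_of_znDef_of_origins_of_Kdd_eq_unconditional {Dα Dβ : ThetaSetting p} {γ : Dα.PiTemp ≃ₜ* Dβ.PiTemp}
    (hOα : Dα.IsEtThOrigin) (hTopα : Dα.HasThetaTopology)
    (hα : Dα.IsThm16Origin) (hβ : Dβ.IsThm16Origin)
    (hTα : Dα.IsTateOrigin) (hTβ' : Dβ.IsTateOrigin)
    (h : ThetaSetting.Thm16i γ) (c : ThetaSetting.ThetaCompanion γ)
    (hΔ : Dα.DeltaTemp.map γ.toMulEquiv.toMonoidHom = Dβ.DeltaTemp)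
    (h65 : Dα.IsoPreservesCuspidalDecomp Dβ.toTemperedCurve)
    (hexα : ∀ N : ℕ+, ∃ s₀ : ↥(Dα.GKN N) → Dα.GtpTheta, Dα.IsThetaSplittingAt N s₀ ∧
      ∀ g : Dα.PiTemp, g ∈ Dα.GtpZN N ↔ g ∈ Dα.GtpYN N ∧ ∃ h' : Dα.aug g ∈ Dα.GJN N,
        Dα.toTheta g * (s₀ ⟨Dα.aug g, Dα.GJN_le_GKN N h'⟩)⁻¹ ∈ Dα.thetaPowersY N)
    (hexβ : ∀ N : ℕ+, ∃ s₀ : ↥(Dβ.GKN N) → Dβ.GtpTheta, Dβ.IsThetaSplittingAt N s₀ ∧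
      ∀ g : Dβ.PiTemp, g ∈ Dβ.GtpZN N ↔ g ∈ Dβ.GtpYN N ∧ ∃ h' : Dβ.aug g ∈ Dβ.GJN N,
        Dβ.toTheta g * (s₀ ⟨Dβ.aug g, Dβ.GJN_le_GKN N h'⟩)⁻¹ ∈ Dβ.thetaPowersY N)
    (Eα : Dα.EtaleThetaData) (Eβ : Dβ.EtaleThetaData)
    (hKβ : Dβ.Kdd = Dβ.K) (h15iiα : ThetaSetting.Prop15ii Eα.toKummerData Dα.compat)
    (h15ii : ThetaSetting.Prop15ii Eβ.toKummerData Dβ.compat)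
    (h15α : ThetaSetting.Prop15iii Eα Dα.compat) (h15β : ThetaSetting.Prop15iii Eβ Dβ.compat)
    {σ : Dβ.PiTemp} (hσ : σ ∈ Dβ.GtpYdd)
    (Vα : ThetaSetting.ValuationHatData Dα Eα.toKummerData)
    (Vβ : ThetaSetting.ValuationHatData Dβ Eβ.toKummerData)
    (hVα : Vα.unitsHat = Dα.unitsOKdd.map Eα.toKddHat) (hVβ : Vβ.unitsHat = Dβ.unitsOKdd.map Eβ.toKddHat)
    (h16ii : ThetaSetting.Thm16ii γ h Eα.toKummerData Eβ.toKummerData Vα Vβ)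
    (hTβ : Dβ.HasThetaTopology) (hOβ : Dβ.IsEtThOrigin)
    {lamβ : ↥((Dβ.DtpYddN 1).map Dβ.toTheta) →ₜ* Dβ.DeltaTheta} (hstdβ : ThetaSetting.IsStdLog lamβ)
    (hresβ : ContH1.res (MonoidHom.id Dβ.GtpTheta) Dβ.DeltaTheta Dβ.map_toTheta_DtpYddN_one_le Eβ.logUdd =
      ThetaSetting.homClass ThetaSetting.dtpYddTheta_le_deltaTheta_map lamβ)
    {ια : Dα.PiTemp ≃ₜ* Dα.PiTemp} (hια : Dα.IsInversionAut ια) (cα : ThetaSetting.ThetaCompanion ια)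
    (hInvα : ThetaSetting.InvClauses Eα hια cα)
    (h15invβ : Dβ.Prop15iiiInvAnchored Eβ)
    (yβ : ThetaSetting.CuspidalPointDd Eβ.toKummerData) (hyβA : yβ.IsAnchored) (hyβ0 : yβ.IsOnLabelZero)
    (hyβfix : Dβ.FixesCuspBelow ((γ.symm.trans ια).trans γ) yβ)
    (y : ThetaSetting.CuspidalPointDd Eβ.toKummerData) {u₁ u₂ v₁ v₂ : (↥Dβ.Kdd)ˣ}
    (hu₁ : u₁ ∈ Dβ.unitsOKdd) (hu₂ : u₂ ∈ Dβ.unitsOKdd)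
    (hv : ‖((v₁ : Dβ.Kdd) : PadicAlgCl p)‖ = ‖((v₂ : Dβ.Kdd) : PadicAlgCl p)‖)
    (h₁ : haveI := Dβ.compat.GtpYdd_normal
      y.evalAt (ContH1.res Dβ.toTheta Dβ.DeltaTheta (y.sec_le.trans y.Dpt_le)
        (ContH1.conj Dβ.toTheta Dβ.DeltaTheta σ Eβ.etaDd)) = Eβ.toKddHat (u₁ * v₁))
    (h₂ : y.evalAt (ContH1.res Dβ.toTheta Dβ.DeltaTheta (y.sec_le.trans y.Dpt_le)
        (ThetaSetting.transport c h Eα.etaDd)) = Eβ.toKddHat (u₂ * v₂)) :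
    ThetaSetting.Thm16iii γ h c Eα Eβ Dβ.compat :=
  thm16iii_of_origins_of_znDef_of_origins_unconditional hOα hTopα hα hβ hTα hTβ' h c hΔ h65 hexα hexβ
    Eα Eβ Dα.compat Dβ.compat (ThetaSetting.sec2Hyps_of_Kdd_eq_of_origins hKβ hβ hTβ') h15iiα h15ii h15α h15β hσ Vα Vβ hVα hVβ h16ii
    hTβ hOβ hstdβ hresβ hια cα hInvα h15invβ yβ hyβA hyβ0 hyβfix y hu₁ hu₂ hv h₁ h₂

end Summit.ABC.IUTFork

end
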